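import Summits.NavierStokesRegularity.NavierStokesRegularity.Theorems.TypeIQuarterGateScarEnvelopeTypeIForcedTsaiSound
import Summits.NavierStokesRegularity.NavierStokesRegularity.Theorems.TypeIQuarterGateScarEnvelopeTypeIForcedTsaiWitnessW5T0a
import Summits.NavierStokesRegularity.NavierStokesRegularity.Theorems.TypeIQuarterGateScarEnvelopeTypeIForcedTsaiWitnessW5T0b

/-!
# Arm-B lane X: the landed witness tables `W5T0a` / `W5T0b` as `ForcedTsaiModulusLE` theorems

Cell ns-wall-extremal (PREREG-WALL-1 A1 §B2(d), lane X; producer ns-wall-eng-5, format/checker/soundness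
by the cert hand ns-crc-p2). The data modules `…ForcedTsaiWitnessW5T0a/b` prove `table.check = true` by kernel
replay (`native_decide`); the cert hand's `WitnessRow.sound` turns every passing row into the analytic statement
`ForcedTsaiModulusLE M δ` («an explicit smooth divergence-free field with `‖curl U‖_{L²(B₁₀)} ≥ M` and weighted
steady backward-Leray vorticity residual `‖(1+ρ)^{5/2} g‖_{L²(ℝ³)} ≤ δ` exists»). This file only composes the two.

Rows (axisymmetric-with-swirl polynomial × Gaussian class, `deg p ≤ 8`, `s = 17/20`, levels 4/8/16/32/64;
plus the no-swirl control at level 16): certified ratios `δ/M` = 39.04 / 39.31 / 40.34 / 41.84 / 42.39 and 48.43.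
Rounded corollaries at level 16: `ForcedTsaiModulusLE 15 646` (with swirl) and `ForcedTsaiModulusLE 15 775` (no swirl).

HONEST FRAME: UPPER bounds on the forced-Tsai modulus of the steady backward-Leray operator in an explicit
witness class («near-profiles this good exist»); never an exclusion, never a statement about blow-up profiles;
Navier–Stokes regularity is OPEN and is not addressed here. `--supports stmt-NavierStokesRegularity-23843 --as helper`.
-/

set_option linter.dupNamespace false

namespace Summit.NavierStokesRegularity.NavierStokesRegularity.Cruxes.ScarEnvelopeTypeI.ForcedTsai

/-- Every row of a passing witness table is an instance of `ForcedTsaiModulusLE`. -/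
theorem WitnessTable.sound {T : WitnessTable} (h : T.check = true) :
    ∀ r ∈ T, ForcedTsaiModulusLE (r.M : ℝ) (r.δ : ℝ) := by
  intro r hr
  exact WitnessRow.sound r (List.all_eq_true.mp h r hr)

/-- Table `W5T0a` (levels 4, 8, 16; axisymmetric with swirl, `d = 8`, `s = 17/20`): every row is a
certified forced-Tsai witness. -/
theorem witnessTableW5T0a_sound :
    ∀ r ∈ witnessTableW5T0a, ForcedTsaiModulusLE (r.M : ℝ) (r.δ : ℝ) :=
  WitnessTable.sound witnessTableW5T0a_check

/-- Table `W5T0b` (levels 32, 64 with swirl; level 16 no-swirl control): every row is a certified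
forced-Tsai witness. -/
theorem witnessTableW5T0b_sound :
    ∀ r ∈ witnessTableW5T0b, ForcedTsaiModulusLE (r.M : ℝ) (r.δ : ℝ) :=
  WitnessTable.sound witnessTableW5T0b_check

/-- Headline corollary at level 16, axisymmetric with swirl (row 3 of `W5T0a`, `M = 15.999999`,
`δ = 645.511…`, rounded outward): a smooth divergence-free field with `‖curl U‖_{L²(B₁₀)} ≥ 15` and
weighted vorticity residual `≤ 646` exists. -/
theorem forcedTsaiModulusLE_15_646 : ForcedTsaiModulusLE 15 646 := by
  have hmem : witnessTableW5T0a[2] ∈ witnessTableW5T0a := List.getElem_mem (by decide)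
  have h := witnessTableW5T0a_sound _ hmem
  refine h.mono ?_ ?_
  · have : (witnessTableW5T0a[2]).M = 15999999 / 1000000 := by rfl
    rw [this]; push_cast; norm_num
  · have : (witnessTableW5T0a[2]).δ = 40344459 / 62500 := by rfl
    rw [this]; push_cast; norm_num

/-- Headline corollary at level 16, NO swirl (control row 3 of `W5T0b`, `M = 15.999999`, `δ = 774.937…`):
a smooth divergence-free axisymmetric no-swirl field with `‖curl U‖_{L²(B₁₀)} ≥ 15` and weighted vorticity
residual `≤ 775` exists (cf. ARM-B DATUM B-w5.1: the no-swirl sector cannot cancel — its certified ratio is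
the larger one). -/
theorem forcedTsaiModulusLE_15_775_noswirl : ForcedTsaiModulusLE 15 775 := by
  have hmem : witnessTableW5T0b[2] ∈ witnessTableW5T0b := List.getElem_mem (by decide)
  have h := witnessTableW5T0b_sound _ hmem
  refine h.mono ?_ ?_
  · have : (witnessTableW5T0b[2]).M = 15999999 / 1000000 := by rfl
    rw [this]; push_cast; norm_num
  · have : (witnessTableW5T0b[2]).δ = 774937061 / 1000000 := by rfl
    rw [this]; push_cast; norm_num

end Summit.NavierStokesRegularity.NavierStokesRegularity.Cruxes.ScarEnvelopeTypeI.ForcedTsai
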